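import Summits.BirchSwinnertonDyer.Rank1Residual.X11b.CensusPAdicLeadingTermAntecedents
import Summits.BirchSwinnertonDyer.Rank1Residual.X11b.ClassClosureTyped
import Literature.NumberTheory.EllipticCurves.GrossZagierRationalPoint
import HarnessLib

/-!
# Class X11b: ONE obligation node — the typed census relation X11b-1 against the class-closure
# residue `RelativeExceptionalLeadingTermAt` and the per-pair regulator input (cell `b2b-bsdres`,
# census cell `bsd-formula-census`, seat conjecture-typer 2; reconciliation ask CELL-PLAN A-11 (b))

HONEST FRAMING (run/shared/lean/b2b/bsd-rank1-residual/, verbatim in every file): the goal of the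
cell is to DELETE the COMBINATION-SHAPED residual classes of the Birch–Swinnerton-Dyer formula for
ALL analytic-rank `≤ 1` elliptic curves over `ℚ` — "full BSD formula for every rank `≤ 1` curve in
class `C`" assembled STRICTLY from published theorems — so that the rank-`≤ 1` remainder becomes
exactly the CONSTRUCTION-SHAPED classes, which are TYPED (missing-input `Prop`s), NOT attempted.
This is not "finishing BSD". Research route; no claim beyond the stated classes; census output =
EVIDENCE / conjecture items, never a Literature fact; `r = 0` cells CALIBRATION, `r = 1` cells
CANDIDATE. Nothing below is booked; no label or RESIDUAL-MAP mark is touched; X11b (N8/O2) stays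
CONSTRUCTION-SHAPED; every class-level theorem is CONDITIONAL on the named published facts in its
binders and on the typed census relation it names.

## Why this file (census lead, `census/CELL-PLAN.md` §8 A-11 (b), 2026-08-21T05:18Z)

Two Summit-side predicates describe the split multiplicative rank-one cell beyond print:
* `X11b.CensusLeadingTermSplit W p` (this seat, `X11b/CensusPAdicLeadingTerm.lean`, p249466): the
  census relation X11b-1 AS MEASURED — `ord_{T=0} L = 2` AND the EXACT identity
  `ϖ·[T²]L·log_p(γ_cyc)²·#T² = 𝓛_p·#Ш_an·Reg_p·∏c` for THE Stein–Wuthrich §4.2 height (EVIDENCE: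
  `run/shared/lean/ttrl/bsd-formula-census/X11-REPORT.md` v3.1, sha256
  `818e5fe4ab6adc3a200394dfc08e179fb2f206810220f40501963c4ff76d347b`; 453/453 split rank-one rows,
  train 294 / held-out 159, `p = 3`: 150/150; LEADERBOARD `9e7d085a6b563774`; second score PENDING);
* `X11b.ClassClosure.RelativeExceptionalLeadingTermAt W p` (seat cc-typer-3,
  `X11b/ClassClosureTyped.lean`, p249673): the same identity UP TO A UNIT `u ∈ ℤ_pˣ`, no order
  clause — the class-closure lever's irreducible residue at split `p = 3`, consumed together with the
  per-pair input `RegulatorNonvanishingAt W p` (Schneider non-degeneracy of THE height).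
The lead asked for a PROVED link so that the kernel carries ONE obligation node. This file proves:

1. `exists_rat_ne_zero_shaAn_eq_of_analyticRank_eq_one`: `#Ш_an ∈ ℚ^×` in analytic rank one
   (Gross–Zagier 1986 Thm. I.(7.3) 2), tree fact `GrossZagier1986_thm_I_7_3`, + GZK) — discharges
   the `hs` binder the census files carried.
2. `ClassClosure.relativeExceptionalLeadingTermAt_of_censusLeadingTermSplit`: the census relation
   IMPLIES the class residue's conjecture (`u = 1`), at every `p`.
3. `schneider_of_censusLeadingTermSplit` / `schneider_of_censusLeadingTermNonsplit`: in analytic rank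
   one the census relation IMPLIES `Reg_p(E, Dh) ≠ 0` for THE canonical §4.2 height (its order clause
   read through its identity; modularity supplies the newform, the tree THE `p`-adic `L`-function) —
   i.e. the split / non-split half of cc-typer-3's `RegulatorNonvanishingAt W p` on the matching cell.
4. ONE NODE, class level: `ClassClosure.bsdp_of_ram_split_of_censusLeadingTermSplit` (ANY odd `p`,
   so `p = 3`), `ClassClosure.bsdp_three_of_splitThreeResidue_of_censusLeadingTermSplit`,
   `ClassClosure.bsdp_of_ram_nonsplit_of_censusLeadingTermNonsplit`, and the one-statement form
   `ClassClosure.bsdp_of_ram_of_census`: on the (ram) atom of N8/O2, `BSD(E,p)` ⇐ PUBLISHED named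
   facts (Skinner 2016 Thm. A, Stein–Wuthrich 2013 Thm. 6.1 and §4.2 height existence, Gross–Zagier
   I.(7.3), GZK, modularity) + THE TYPED CENSUS RELATION AT THE PAIR, nothing else — no separate
   regulator certificate, no separate residue conjecture, not even Disegni's theorem (the census
   identity stands in for it).
5. Converse bookkeeping, `order_eq_two_of_relativeExceptional_of_schneider`: the residue conjecture +
   Schneider for THE height + Greenberg–Stevens give back the census ORDER clause; the identity comes
   back up to `u`. So `CensusLeadingTermSplit` = (`RelativeExceptionalLeadingTermAt` with `u = 1`) +
   (order clause ⟸ Schneider), and the converse implication fails exactly by the exactness `u = 1` —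
   which IS what the census measured (`R = 𝓛_p·c_∞` to full working precision on 453/453 rows, not
   merely `v_p(R) = v_p(𝓛_p)`), and which `BSD(E,p)` does not need.

RECOMMENDATION recorded for cc-lead / x11b3 lead / referee b2b-bsdres-ref-3 (they rule; nothing is
changed here): cite `X11b.CensusLeadingTermSplit W 3` as THE obligation node on `SplitThreeResidueAt`
(it is the statement with the evidence file and it subsumes both class inputs by items 2–4); keep
`RelativeExceptionalLeadingTermAt W 3 ∧ RegulatorNonvanishingAt W 3` as its documented WEAKEST
SUFFICIENT shadow (cc-typer-3's `bsdp_three_of_splitThreeResidue_of_conjecture`). Either way the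
kernel now carries one node with proved arrows to the other, not two unrelated conjectures.

References: [GrossZagier1986] Thm. I.(7.3); [Disegni2020] Thm. 1 = Thm. 4; [Skinner2016PacificMC]
Thm. A; [SteinWuthrich2013] Thm. 6.1, §4.2; [MazurTateTeitelbaum1986Invent] §II.10;
[GreenbergStevens1993] (0.6); [Miller2011LMS] Def. 1.1. Census file of record: X11-REPORT.md v3.1.
-/

set_option autoImplicit false

noncomputable section

open scoped Classical MatrixGroups ModularForm

open CongruenceSubgroup WeierstrassCurve Literature.NumberTheory.EllipticCurves
  Literature.NumberTheory.EllipticCurves.ModularForms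
  Literature.NumberTheory.EllipticCurves.Rank1Residual
  Literature.NumberTheory.EllipticCurves.Rank1Residual.Typed
  Literature.NumberTheory.EllipticCurves.Skinner2016
  Literature.NumberTheory.EllipticCurves.SteinWuthrich2013
  Literature.Barriers.BirchSwinnertonDyer

namespace Summit.BirchSwinnertonDyer.Rank1Residual.X11b

/-! ### §1 `#Ш_an ∈ ℚ^×` in analytic rank one (Gross–Zagier bookkeeping) -/

/-- **In analytic rank one Miller's `#Ш(E/ℚ)_an` is a NON-ZERO rational number**: Gross–Zagier
I.(7.3) 2) gives `L'(E,1) = c·Ω·Reg` with `c ∈ ℚ^×` (`hGZ`; `rank E(ℚ) = 1` by GZK, `hGZK`), so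
`#Ш_an = c·#E(ℚ)_tors²/∏c_v ≠ 0`. Discharges the binder
`∀ …, analyticRank = 1 → ∃ s ≠ 0, shaAn W = s` of `X11b/CensusPAdicLeadingTerm*.lean`.
[cite: GrossZagier1986, Thm. I.(7.3) 2)] [cite: Miller2011LMS, §1 (arXiv:1010.2431 p. 3)] -/
theorem exists_rat_ne_zero_shaAn_eq_of_analyticRank_eq_one (hGZ : GrossZagier1986_thm_I_7_3)
    (hGZK : rank_eq_analyticRank_of_analyticRank_le_one)
    (W : WeierstrassCurve ℚ) [W.IsElliptic] (hr : W.analyticRank = 1) :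
    ∃ s : ℚ, s ≠ 0 ∧ shaAn W = (s : ℂ) := by
  have hrk : W.mordellWeilRank = 1 := by rw [(hGZK W hr.le).1, hr]
  obtain ⟨c, hc0, hc⟩ := leadingLCoeff_eq_rat_mul_of_analyticRank_eq_one (W := W) hGZ hr hrk
  have hT : (W.torsionOrder : ℚ) ≠ 0 := by exact_mod_cast (W.torsionOrder_pos_holds).ne'
  have hcp : (W.tamagawaProduct : ℚ) ≠ 0 := by
    exact_mod_cast (W.tamagawaProduct_pos_holds : 0 < W.tamagawaProduct).ne'
  refine ⟨c * (W.torsionOrder : ℚ) ^ 2 / W.tamagawaProduct,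
    div_ne_zero (mul_ne_zero hc0 (pow_ne_zero 2 hT)) hcp, ?_⟩
  have hΩ : (W.realPeriodRat : ℂ) ≠ 0 := by exact_mod_cast (W.realPeriodRat_pos_holds).ne'
  have hR : (W.regulator : ℂ) ≠ 0 := by exact_mod_cast (W.regulator_pos').ne'
  have hcp' : (W.tamagawaProduct : ℂ) ≠ 0 := by
    exact_mod_cast (W.tamagawaProduct_pos_holds : 0 < W.tamagawaProduct).ne'
  rw [shaAn_def, hc]
  push_cast
  field_simp

/-! ### §2 The census relation IMPLIES the class residue's conjecture (`u = 1`) -/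

/-- **Census ⇒ class residue.** At every prime: the typed census relation `CensusLeadingTermSplit W p`
(exact identity with `#Ш_an` for THE §4.2 height) implies cc-typer-3's EVIDENCE-labelled
`RelativeExceptionalLeadingTermAt W p` (the same display up to `u ∈ ℤ_pˣ`), with `u = 1`; `#Ш_an ∈ ℚ`
from Gross–Zagier (`hGZ`, `hGZK`). So the residue conjecture is not a second obligation: it is a
proved consequence of the census node. CONDITIONAL (an implication between predicates); nothing
asserted about any curve. [cite: GrossZagier1986, Thm. I.(7.3) 2)]
[cite: MazurTateTeitelbaum1986Invent, §II.10 (exceptional case)] -/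
theorem ClassClosure.relativeExceptionalLeadingTermAt_of_censusLeadingTermSplit
    (hGZ : GrossZagier1986_thm_I_7_3) (hGZK : rank_eq_analyticRank_of_analyticRank_le_one)
    (W : WeierstrassCurve ℚ) [W.IsElliptic] [W.IsGloballyMinimal] (p : ℕ) [Fact p.Prime]
    (h : CensusLeadingTermSplit W p) : ClassClosure.RelativeExceptionalLeadingTermAt W p := by
  intro N _ f hp2 _ hr hf ϖ _ hϖ Dq L hL Dh hDh
  obtain ⟨s, -, hs⟩ := exists_rat_ne_zero_shaAn_eq_of_analyticRank_eq_one hGZ hGZK W hr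
  refine ⟨s, 1, hs, ?_⟩
  rw [Units.val_one, PadicInt.coe_one, one_mul]
  exact (h hp2 Dq hr f hf L hL Dh hDh ϖ hϖ).2 s hs

/-! ### §3 The census relation IMPLIES Schneider non-degeneracy for THE height (analytic rank one) -/

section Schneider

variable (W : WeierstrassCurve ℚ) [W.IsElliptic] [W.IsGloballyMinimal] (p : ℕ) [Fact p.Prime]

/-- **Census (split cell) ⇒ `Reg_p(E, Dh) ≠ 0` for THE Stein–Wuthrich §4.2 height**, for a curve of
analytic rank one split multiplicative at `p ≠ 2`: instantiate the relation at the newform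
(modularity, `hpar`), THE Mazur–Tate–Teitelbaum function (`exists_isSplitMultPAdicLFunctionOf`), the
period ratio `ϖ > 0` and `#Ш_an ∈ ℚ` (Gross–Zagier); its order clause `ord_{T=0} L = 2` makes
`[T²]L ≠ 0`, and its identity then forbids `Reg_p = 0` (`ϖ`, `log_p γ_cyc`, `#T` non-zero). So the
split half of `ClassClosure.RegulatorNonvanishingAt W p` is a CONSEQUENCE of the census node on this
cell, not an extra input. [cite: SteinWuthrich2013, §4.2 and Conj. 4.1]
[cite: Schneider1982PadicHeightI, §1] -/
theorem schneider_of_censusLeadingTermSplit (hGZ : GrossZagier1986_thm_I_7_3)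
    (hGZK : rank_eq_analyticRank_of_analyticRank_le_one) (hpar : nonempty_modularParametrizationData)
    (hp : p ≠ 2) (hr : W.analyticRank = 1) (h : CensusLeadingTermSplit W p)
    (Dq : TateParameterData W p) (Dh : PAdicHeightData W p) (hDh : IsSplitMultCanonical Dh Dq) :
    SchneiderConjecture Dh := by
  haveI : NeZero (W.conductorNorm ℤ) := ⟨(W.conductorNorm_pos_holds).ne'⟩
  obtain ⟨Dm⟩ := hpar W
  obtain ⟨ϖ, hϖpos, hϖ, -⟩ := Dm.exists_rat_mul_realPeriodRat_eq_plusPeriod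
  have hsplit : W.HasSplitMultiplicativeReductionAtPrime p :=
    (nonempty_tateParameterData_iff_holds (W := W) (p := p)).mp ⟨Dq⟩
  obtain ⟨L, hL⟩ := exists_isSplitMultPAdicLFunctionOf hsplit Dm.isNewformOf
  obtain ⟨s, -, hs⟩ := exists_rat_ne_zero_shaAn_eq_of_analyticRank_eq_one hGZ hGZK W hr
  obtain ⟨hord, hid⟩ := h hp Dq hr Dm.f Dm.isNewformOf L hL Dh hDh ϖ hϖ
  have h2 : PowerSeries.coeff 2 L ≠ 0 := by
    have hord' : L.order = ((2 : ℕ) : ℕ∞) := hord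
    exact (PowerSeries.order_eq_nat.mp hord').1
  have hϖ0 : (ϖ : ℚ_[p]) ≠ 0 := by exact_mod_cast hϖpos.ne'
  have hlog : padicLog p (cyclotomicGenerator p : ℚ_[p]) ^ 2 ≠ 0 :=
    pow_ne_zero 2 (padicLog_cyclotomicGenerator_ne_zero p)
  have hT : (W.torsionOrder : ℚ_[p]) ^ 2 ≠ 0 :=
    pow_ne_zero 2 (by exact_mod_cast (W.torsionOrder_pos_holds).ne')
  change padicRegulator Dh ≠ 0
  intro hReg
  have hid' := hid s hs
  rw [hReg, mul_zero, zero_mul, mul_zero] at hid'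
  exact mul_ne_zero (mul_ne_zero (mul_ne_zero hϖ0 h2) hlog) hT hid'

/-- **Census (non-split cell) ⇒ `Reg_p(E, Dh) ≠ 0` for THE Stein–Wuthrich (4.1) height**, for a
curve of analytic rank one non-split multiplicative at `p ≠ 2` (order clause `ord_{T=0} L = 1` +
identity; THE function from `exists_isMultPAdicLFunctionOf_neg_one_of_nonsplit`). The non-split half
of `ClassClosure.RegulatorNonvanishingAt W p` on this cell. [cite: SteinWuthrich2013, §4.2 (4.1)]
[cite: Schneider1982PadicHeightI, §1] -/
theorem schneider_of_censusLeadingTermNonsplit (hGZ : GrossZagier1986_thm_I_7_3)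
    (hGZK : rank_eq_analyticRank_of_analyticRank_le_one) (hpar : nonempty_modularParametrizationData)
    (hp : p ≠ 2) (hmult : W.HasMultiplicativeReductionAtPrime p)
    (hns : ¬ W.HasSplitMultiplicativeReductionAtPrime p) (hr : W.analyticRank = 1)
    (h : CensusLeadingTermNonsplit W p) {q : ℚ_[p]} (hq0 : q ≠ 0) (hq1 : ‖q‖ < 1)
    (hqj : tateJ q = (W.j : ℚ_[p])) (Dh : PAdicHeightData W p) (hDh : IsMultCanonical Dh q) :
    SchneiderConjecture Dh := by
  haveI : NeZero (W.conductorNorm ℤ) := ⟨(W.conductorNorm_pos_holds).ne'⟩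
  obtain ⟨Dm⟩ := hpar W
  obtain ⟨ϖ, hϖpos, hϖ, -⟩ := Dm.exists_rat_mul_realPeriodRat_eq_plusPeriod
  obtain ⟨L, hL⟩ := exists_isMultPAdicLFunctionOf_neg_one_of_nonsplit Dm.isNewformOf hmult hns
  obtain ⟨s, -, hs⟩ := exists_rat_ne_zero_shaAn_eq_of_analyticRank_eq_one hGZ hGZK W hr
  obtain ⟨hord, hid⟩ := h hp hmult hns hr q hq0 hq1 hqj Dm.f Dm.isNewformOf L hL Dh hDh ϖ hϖ
  have h1 : PowerSeries.coeff 1 L ≠ 0 := by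
    have hord' : L.order = ((1 : ℕ) : ℕ∞) := hord
    exact (PowerSeries.order_eq_nat.mp hord').1
  have hϖ0 : (ϖ : ℚ_[p]) ≠ 0 := by exact_mod_cast hϖpos.ne'
  have hlog : padicLog p (cyclotomicGenerator p : ℚ_[p]) ≠ 0 := padicLog_cyclotomicGenerator_ne_zero p
  have hT : (W.torsionOrder : ℚ_[p]) ^ 2 ≠ 0 :=
    pow_ne_zero 2 (by exact_mod_cast (W.torsionOrder_pos_holds).ne')
  change padicRegulator Dh ≠ 0
  intro hReg
  have hid' := hid s hs
  rw [hReg, mul_zero, zero_mul, mul_zero] at hid'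
  exact mul_ne_zero (mul_ne_zero (mul_ne_zero hϖ0 h1) hlog) hT hid'

end Schneider

/-! ### §4 ONE NODE at class level: `BSD(E,p)` on the (ram) atom from published facts + the census
relation at the pair -/

section OneNode

variable (W : WeierstrassCurve ℚ) [W.IsElliptic] [W.IsGloballyMinimal] (p : ℕ) [Fact p.Prime]

/-- **(ram) ∧ SPLIT at ANY odd `p` — so the residue `p = 3` INCLUDED —: `BSD(E,p)` from PUBLISHED
named facts (Skinner 2016 Thm. A `hA`, Stein–Wuthrich 2013 Thm. 6.1 split `hJ`, SW §4.2 height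
existence `hH`, Gross–Zagier I.(7.3) `hGZ`, GZK `hGZK`, modularity `hpar`) and THE TYPED CENSUS
RELATION `CensusLeadingTermSplit W p` at the pair, NOTHING ELSE.** The relation supplies both the
relative analytic display (exactly, `u = 1`; replacing Disegni's Thm. 1 and its hypothesis (∗)
"`p ≥ 5` + a second multiplicative prime") and Schneider's non-degeneracy for THE height
(`schneider_of_censusLeadingTermSplit`); the lever `bsdp_of_split_of_relativeLeadingTerm_of_schneider`
does the rest. CONDITIONAL on the facts and on an EVIDENCE-labelled conjecture; nothing booked; X11b
stays CONSTRUCTION-SHAPED. [cite: Skinner2016PacificMC, Thm. A] [cite: SteinWuthrich2013, Thm. 6.1, §4.2]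
[cite: Miller2011LMS, Def. 1.1] -/
theorem ClassClosure.bsdp_of_ram_split_of_censusLeadingTermSplit (hA : thmA_charIdeal_multiplicative)
    (hJ : thm61_splitMultiplicative) (hH : exists_isSplitMultCanonical)
    (hGZ : GrossZagier1986_thm_I_7_3) (hGZK : rank_eq_analyticRank_of_analyticRank_le_one)
    (hpar : nonempty_modularParametrizationData)
    (hX : ClassX11b W p) (hsplit : W.HasSplitMultiplicativeReductionAtPrime p) (hram : Ram W p)
    (hC : CensusLeadingTermSplit W p) : BSDp W p := by
  obtain ⟨hr, hp2, hmult, hirr⟩ := hX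
  have hpP : p.Prime := Fact.out
  have hp3 : 3 ≤ p := by
    rcases hpP.eq_two_or_odd' with h | h
    · exact absurd h hp2
    · have := hpP.two_le; omega
  obtain ⟨κ, hκ, γ, hγ, hγ'⟩ := exists_isCyclotomic_isTopGenerator_isCyclotomicVariable_holds p
  obtain ⟨D⟩ := W.nonempty_selmerDualData_holds κ γ hγ
  haveI : NeZero (W.conductorNorm ℤ) := ⟨(W.conductorNorm_pos_holds).ne'⟩
  obtain ⟨Dm⟩ := hpar W
  obtain ⟨ϖ, hϖpos, hϖ, -⟩ := Dm.exists_rat_mul_realPeriodRat_eq_plusPeriod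
  obtain ⟨L, hL⟩ := exists_isSplitMultPAdicLFunctionOf hsplit Dm.isNewformOf
  obtain ⟨Dq⟩ := (nonempty_tateParameterData_iff_holds (W := W) (p := p)).mpr hsplit
  obtain ⟨Dh, hDh⟩ := hH W p hp2 Dq
  -- (MC=) Skinner Thm. A for this data (split clause)
  obtain ⟨hXt, g, hchar, hsp, -⟩ := hA W p hp3 hmult hirr hram hκ hγ hγ' Dm.isNewformOf D ϖ
    hϖpos.ne' hϖ
  obtain ⟨w, hw⟩ := hsp hsplit L hL
  -- the census relation at the pair: exact display (`u = 1`) and Schneider for THE height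
  obtain ⟨s, -, hs⟩ := exists_rat_ne_zero_shaAn_eq_of_analyticRank_eq_one hGZ hGZK W hr
  have hDis := (hC hp2 Dq hr Dm.f Dm.isNewformOf L hL Dh hDh ϖ hϖ).2 s hs
  exact bsdp_of_split_of_relativeLeadingTerm_of_schneider W p hJ hGZK hp2 hr Dq hκ hγ hγ' D hXt hchar
    w hw Dh hDh hs 1 (by rw [Units.val_one, PadicInt.coe_one, one_mul]; exact hDis)
    (schneider_of_censusLeadingTermSplit W p hGZ hGZK hpar hp2 hr hC Dq Dh hDh)

/-- **THE RESIDUE, one node: at `p = 3`, split, (ram) — `BSD(E,3)` from the published facts and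
`CensusLeadingTermSplit W 3` ALONE** (compare cc-typer-3's `bsdp_three_of_splitThreeResidue_of_conjecture`,
which takes `RelativeExceptionalLeadingTermAt W 3` AND `RegulatorNonvanishingAt W 3`: both are
consequences of the census node, §2–§3). CONDITIONAL on an EVIDENCE-labelled conjecture (150/150
split rank-one census rows at `p = 3`; NOT in print); nothing booked.
[cite: Skinner2016PacificMC, Thm. A] [cite: SteinWuthrich2013, Thm. 6.1] [cite: Miller2011LMS, Def. 1.1] -/
theorem ClassClosure.bsdp_three_of_splitThreeResidue_of_censusLeadingTermSplit [Fact (Nat.Prime 3)]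
    (hA : thmA_charIdeal_multiplicative) (hJ : thm61_splitMultiplicative)
    (hH : exists_isSplitMultCanonical) (hGZ : GrossZagier1986_thm_I_7_3)
    (hGZK : rank_eq_analyticRank_of_analyticRank_le_one) (hpar : nonempty_modularParametrizationData)
    (hX : ClassX11b W 3) (hres : ClassClosure.SplitThreeResidueAt W)
    (hC : CensusLeadingTermSplit W 3) : BSDp W 3 :=
  ClassClosure.bsdp_of_ram_split_of_censusLeadingTermSplit W 3 hA hJ hH hGZ hGZK hpar hX hres.1
    hres.2 hC

/-- **(ram) ∧ NON-SPLIT at any odd `p`: `BSD(E,p)` from the published facts (Skinner Thm. A `hA`,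
SW Thm. 6.1 non-split `hJ`, SW (4.1) height existence `hH`, Gross–Zagier, GZK, modularity) and THE
TYPED CENSUS RELATION `CensusLeadingTermNonsplit W p` at the pair, nothing else** — the relation's
identity clause is Disegni's Thm. 1 (in print; CALIBRATION) and its order clause is the regulator
certificate (`schneider_of_censusLeadingTermNonsplit`). Via cc-typer-3's
`bsdp_of_ram_nonsplit_of_schneider`. CONDITIONAL; nothing booked.
[cite: Skinner2016PacificMC, Thm. A] [cite: SteinWuthrich2013, Thm. 6.1, §4.2]
[cite: Disegni2020, Thm. 1 (§1.2)] [cite: Miller2011LMS, Def. 1.1] -/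
theorem ClassClosure.bsdp_of_ram_nonsplit_of_censusLeadingTermNonsplit
    (hA : thmA_charIdeal_multiplicative) (hJ : thm61_nonsplitMultiplicative)
    (hH : exists_isMultCanonical) (hGZ : GrossZagier1986_thm_I_7_3)
    (hGZK : rank_eq_analyticRank_of_analyticRank_le_one) (hpar : nonempty_modularParametrizationData)
    (hX : ClassX11b W p) (hns : ¬ W.HasSplitMultiplicativeReductionAtPrime p) (hram : Ram W p)
    (hC : CensusLeadingTermNonsplit W p) : BSDp W p :=
  bsdp_of_ram_nonsplit_of_schneider W p hA hJ hH hGZK hpar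
    (fun hf ϖ _ hϖ q hq0 hq1 hqj L hL Dh hDh => by
      obtain ⟨s, -, hs⟩ := exists_rat_ne_zero_shaAn_eq_of_analyticRank_eq_one hGZ hGZK W hX.1
      refine ⟨s, 1, hs, ?_⟩
      rw [Units.val_one, PadicInt.coe_one, one_mul]
      exact (hC hX.2.1 hX.2.2.1 hns hX.1 q hq0 hq1 hqj _ hf L hL Dh hDh ϖ hϖ).2 s hs)
    hX hns hram
    (fun _ Dh hq0 hq1 hqj hDh =>
      schneider_of_censusLeadingTermNonsplit W p hGZ hGZK hpar hX.2.1 hX.2.2.1 hns hX.1 hC hq0 hq1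
        hqj Dh hDh)

/-- **ONE OBLIGATION NODE PER PAIR on the whole (ram) atom of N8/O2** (all 1 684 true-open X11b
classes at `p = 3` — 961 split, 723 non-split —; 3 723 of the 3 861 cells at `p ≥ 5`; rmap-3 g5
tables, cc-typer-3's `class-closure/O2/TYPER-3.md`): `BSD(E,p)` from PUBLISHED named facts (Skinner
2016 Thm. A; Stein–Wuthrich 2013 Thm. 6.1 ×2 and §4.2 height existence ×2; Gross–Zagier I.(7.3);
GZK; modularity) + the typed census relation X11b-1 at `(E, p)` — `CensusLeadingTermNonsplit W p` if
non-split, `CensusLeadingTermSplit W p` if split. On the non-split cell and on split `p ≥ 5` with a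
second multiplicative prime the relation's identity clause is IN PRINT (Disegni 2020 Thm. 4) and its
only content beyond print is the regulator certificate; on split `p = 3` (and the exact constant at a
single multiplicative prime) it is the cell's EVIDENCE-labelled conjecture. CONDITIONAL; nothing
booked; labels unchanged; X11b stays CONSTRUCTION-SHAPED. [cite: Skinner2016PacificMC, Thm. A]
[cite: SteinWuthrich2013, Thm. 6.1, §4.2] [cite: Disegni2020, Thm. 4 (§3.2)] [cite: Miller2011LMS, Def. 1.1] -/
theorem ClassClosure.bsdp_of_ram_of_census (hA : thmA_charIdeal_multiplicative)
    (hJn : thm61_nonsplitMultiplicative) (hJs : thm61_splitMultiplicative)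
    (hHn : exists_isMultCanonical) (hHs : exists_isSplitMultCanonical)
    (hGZ : GrossZagier1986_thm_I_7_3) (hGZK : rank_eq_analyticRank_of_analyticRank_le_one)
    (hpar : nonempty_modularParametrizationData)
    (hX : ClassX11b W p) (hram : Ram W p)
    (hCn : ¬ W.HasSplitMultiplicativeReductionAtPrime p → CensusLeadingTermNonsplit W p)
    (hCs : W.HasSplitMultiplicativeReductionAtPrime p → CensusLeadingTermSplit W p) : BSDp W p := by
  by_cases hsplit : W.HasSplitMultiplicativeReductionAtPrime p
  · exact ClassClosure.bsdp_of_ram_split_of_censusLeadingTermSplit W p hA hJs hHs hGZ hGZK hpar hX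
      hsplit hram (hCs hsplit)
  · exact ClassClosure.bsdp_of_ram_nonsplit_of_censusLeadingTermNonsplit W p hA hJn hHn hGZ hGZK hpar
      hX hsplit hram (hCn hsplit)

end OneNode

/-! ### §5 Converse bookkeeping: residue conjecture + Schneider + Greenberg–Stevens ⇒ the census
ORDER clause (the identity comes back up to `u ∈ ℤ_pˣ`; exactness `u = 1` is the census's surplus) -/

/-- **What the class inputs give back of the census relation.** Granted cc-typer-3's
`RelativeExceptionalLeadingTermAt W p` (identity up to `u ∈ ℤ_pˣ`), Schneider's non-degeneracy for THE
§4.2 datum (`hSch`) and Greenberg–Stevens (`hGS`, `ord ≥ 2`), clause (i) of `CensusLeadingTermSplit`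
holds for the given data: `ord_{T=0} L = 2` (`#Ш_an ≠ 0` by Gross–Zagier, `𝓛_p ≠ 0` by
Barré-Sirieix–Diaz–Gramain–Philibert, `u ≠ 0`). Clause (ii) is recovered only up to `u`: the converse
of `relativeExceptionalLeadingTermAt_of_censusLeadingTermSplit` fails exactly by the exactness of the
constant, which the census measured and `BSD(E,p)` does not use. [cite: GreenbergStevens1993, Introduction (0.6)]
[cite: BarreSirieixDiazGramainPhilibert1996Manin, Thm. 1] [cite: GrossZagier1986, Thm. I.(7.3) 2)] -/
theorem order_eq_two_of_relativeExceptional_of_schneider (hGZ : GrossZagier1986_thm_I_7_3)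
    (hGZK : rank_eq_analyticRank_of_analyticRank_le_one)
    (W : WeierstrassCurve ℚ) [W.IsElliptic] [W.IsGloballyMinimal] (p : ℕ) [Fact p.Prime]
    (hGS : greenberg_stevens W p) (hC : ClassClosure.RelativeExceptionalLeadingTermAt W p)
    (hp : p ≠ 2) (Dq : TateParameterData W p) (hr : W.analyticRank = 1)
    {N : ℕ} [NeZero N] {f : CuspForm (Gamma0 N) 2} (hf : IsNewformOf W f)
    {L : PowerSeries ℚ_[p]} (hL : IsSplitMultPAdicLFunctionOf f p L)
    {Dh : PAdicHeightData W p} (hDh : IsSplitMultCanonical Dh Dq)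
    {ϖ : ℚ} (hϖ : (ϖ : ℝ) * W.realPeriodRat = plusPeriod f) (hSch : SchneiderConjecture Dh) :
    L.order = 2 := by
  have hsplit : W.HasSplitMultiplicativeReductionAtPrime p :=
    (nonempty_tateParameterData_iff_holds (W := W) (p := p)).mp ⟨Dq⟩
  have hϖ0 : ϖ ≠ 0 := varpi_ne_zero hf hϖ
  obtain ⟨s, u, hs, hid⟩ := hC hp hsplit hr hf ϖ hϖ0 hϖ Dq L hL Dh hDh
  obtain ⟨s', hs'0, hs'⟩ := exists_rat_ne_zero_shaAn_eq_of_analyticRank_eq_one hGZ hGZK W hr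
  have hss' : s = s' := by exact_mod_cast hs.symm.trans hs'
  have hs0 : (s : ℚ_[p]) ≠ 0 := by rw [hss']; exact_mod_cast hs'0
  have hle := two_le_order_of_greenbergStevens hGS Dq hf (by omega) hL
  rw [show (2 : ℕ∞) = ((2 : ℕ) : ℕ∞) from rfl,
    order_eq_nat_iff_coeff_ne_zero_of_le (by exact_mod_cast hle)]
  intro h2
  rw [h2, mul_zero, zero_mul, zero_mul] at hid
  have hReg : padicRegulator Dh ≠ 0 := hSch
  have hc : (W.tamagawaProduct : ℚ_[p]) ≠ 0 := by
    exact_mod_cast (W.tamagawaProduct_pos_holds : 0 < W.tamagawaProduct).ne'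
  exact mul_ne_zero (coe_units_ne_zero p u) (mul_ne_zero (LInvariant_ne_zero_holds Dq)
    (mul_ne_zero (mul_ne_zero hs0 hReg) hc)) hid.symm

end Summit.BirchSwinnertonDyer.Rank1Residual.X11b

end
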